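import Summits.BirchSwinnertonDyer.Rank1Residual.Partition.Rows
import Literature.NumberTheory.EllipticCurves.Rank1Residual.Typed.KimCertificate
import Literature.NumberTheory.EllipticCurves.Rank1Residual.X9SmallImage
import Literature.NumberTheory.EllipticCurves.LocalTorsionGoodReductionProofs
import HarnessLib

/-!
# Row C2 (census row D1) re-routed to C.-H. Kim, Amer. J. Math. 148 (2026) Thm. 1.8 (6): `BSD(E,p)`
# from ONE unit Kurihara number — no `hBCS` (cell `bsd-litref`, tranche T2a, paper bcs25, prover seat)

HONEST FRAMING (cell `b2b-bsdres`, run/shared/lean/b2b/bsd-rank1-residual/, verbatim in every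
partition file): the goal of the cell is to DELETE the COMBINATION-SHAPED residual classes of the
Birch–Swinnerton-Dyer formula for ALL analytic-rank `≤ 1` elliptic curves over `ℚ` — "full BSD
formula for every rank `≤ 1` curve in class `C`" assembled STRICTLY from published theorems — so
that the rank-`≤ 1` remainder becomes exactly the CONSTRUCTION-SHAPED classes, which are TYPED
(missing-input `Prop`s), NOT attempted. This is not "finishing BSD". Theorems only; NO definition,
NO named fact introduced here; every published theorem enters as one of the tree's existing named
Literature facts BY NAME; nothing about any particular curve is asserted; no label changes; no
census number moves here (the re-tiering of D1 cells is referee A's booking on per-pair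
two-engine Kurihara-number certificates).

Row C2 of the partition (`RowC2 W p := ¬cm ∧ 3 < p ∧ GoodOrd ∧ Irr ∧ BigIm`, `Partition/Rows.lean`)
is bound to Burungale–Castella–Skinner 2025 Cor. 1.3.1 (`RowC2.bsdp`, binder `hBCS`, PUB\*; census
row D1 = the cells whose ONLY class-level cover is C2, literal under the composite flag
`BCS25-IMC-equiv@BSTW+Wan15-Thm3@Fuj06(unpublished)+Hid04-gap`). The sibling file
`Partition/CornersFlagFree.lean` re-routes the sub-locus `r = 1 ∧ zhang(p)` to W. Zhang 2014
Thm. 1.6 (booked R336). THIS file re-routes the PER-PAIR Kurihara-number locus to Kim's structure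
theorem (C.-H. Kim, *The structure of Selmer groups and the Iwasawa main conjecture for elliptic
curves*, Amer. J. Math. 148 (2026) 79–129, Thm. 1.8 (6) = arXiv:2203.12159v4 Thm. 1.9 (6), with
Cor. 1.6 and §1.3.5) — tree facts `Kim2022_rankZero_padicValRat_sha_of_kuriharaNumber_ne_zero` /
`Kim2022_rankOne_card_sha_eq_one_of_kuriharaNumber_ne_zero` (file `KuriharaNumberKimShaLength`,
PUBLISHED; ARM P D-audit sheet `D-AUDIT-r10.md` cfa522325b7b7321 attached the reading flag
`K26-(6)-shallow@t>0` and the PROOF-COVERED twins `…_of_localTorsionTrivial`, file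
`KuriharaNumberKimShaLengthLocalTorsionTrivial`), through the cell's class-agnostic consumers
`Typed.bsdp_of_kim_rankZero_of_kuriharaNumber_ne_zero` / `Typed.bsdp_of_kim_rankOne_of_kuriharaNumber_ne_zero`
(`Rank1Residual/Typed/KimCertificate.lean`). Kim's theorem carries NO hypothesis on the conductor,
so the non-semistability that defines D1 is immaterial; a row-C2 cell has `p ≥ 5` (a prime `> 3`),
good ordinary reduction and `ρ̄_{E,p}` onto (`Irr ∧ BigIm ⇒ Surj`, `surj_of_irr_of_bigIm`) — exactly
Kim's standing hypotheses, the Manin-constant hypothesis being vacuous at a prime of good reduction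
(§1.3.5) — and the period transfer `Ω(W) = u·Ω⁺_f`, `|u|_p = 1` is the tree fact
`realPeriodRat_eq_unit_mul_plusPeriod` (Greenberg–Vatsal 2000 Rem. 3.4 + Mazur 1978 Cor. 4.1 +
Edixhoven 1991; binder `hϖ`). PER PAIR the lane supplies: the newform `f`, a Kolyvagin level `n`
(primes `ℓ ∤ Np`, `ℓ ≡ 1`, `a_ℓ ≡ 2 (mod p)`, cyclic `p`-part of `Ẽ(𝔽_ℓ)`), surjective discrete
logarithms `ψ`, the certificate `kuriharaNumber f p n ψ ≠ 0` (`δ̃_n ≢ 0 (mod p)`, a finite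
modular-symbol computation, two engines), and the side conditions `p ∤ ∏ c_ℓ · #E(ℚ)_tors` (rank `0`;
by Kim's Conjecture 1.10 a unit Kurihara number can only exist when `p ∤ ∏ c_ℓ`) resp.
`ord_p #Ш_an = 0` (rank `1`). Four doors:

* `RowC2.bsdp_rankZero_of_kim` / `RowC2.bsdp_rankOne_of_kim` — over the landed facts B5 / B6;
* `RowC2.bsdp_rankZero_of_kim_nonAnomalous` / `RowC2.bsdp_rankOne_of_kim_nonAnomalous` — over the
  PROOF-COVERED twins, with the `(t0)` binder `#E(ℚ_p)[p] = 1` DISCHARGED by `a_p ≢ 1 (mod p)`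
  (`natCard_localPTorsion_eq_one_of_good_of_not_dvd_frobeniusTrace_sub_one`, via the tree readings
  `Kim2022_…_of_nonAnomalous` of `LocalTorsionGoodReductionProofs`): the flag-free shape at a
  non-anomalous good `p`.

Binders: `hKim` (one of the four Kim facts), `hϖ`, modularity `hmod`, GZK `hGZK` — NO `hBCS`,
NO `hYZ`, NO main conjecture, NO Heegner index. Imports: partition `Rows` + Literature only (no
`Theses` module). References: Kim 2026 [Kim2022StructureSelmer]; Greenberg–Vatsal 2000 Rem. 3.4
[GreenbergVatsal2000]; Mazur 1978 Cor. 4.1 [Mazur1978]; Miller 2011 Def. 1.1 [Miller2011LMS];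
Silverman AEC VII.3.1 [SilvermanAEC2009]; RESIDUAL-CASES §a.1 row C15 / lever L5 (T-KIM0 / T-KIM1),
referee A R183.5 (Kim certificates admitted per pair).
-/

noncomputable section

namespace Summit.BirchSwinnertonDyer.Rank1Residual

open scoped Classical MatrixGroups ModularForm
open CongruenceSubgroup WeierstrassCurve Literature.NumberTheory.EllipticCurves
  Literature.NumberTheory.EllipticCurves.Rank1Residual Literature.NumberTheory.EllipticCurves.ModularForms

section Curve

variable {W : WeierstrassCurve ℚ} [W.IsElliptic] [W.IsGloballyMinimal] {p : ℕ} [Fact p.Prime]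

omit [W.IsElliptic] in
/-- A row-C2 prime is at least `5` (it is a prime `> 3`). [folklore] -/
theorem RowC2.five_le (h : RowC2 W p) : 5 ≤ p := by
  obtain ⟨-, hp3, -, -, -⟩ := h
  have hp2 : p ≠ 2 := by omega
  have hp3' : p ≠ 3 := by omega
  exact (Fact.out : p.Prime).five_le_of_ne_two_of_ne_three hp2 hp3'

/-- **Row C2, analytic rank zero, ONE unit Kurihara number ⇒ `BSD(E,p)` from Kim 2026 Thm. 1.8 (6)
— no `hBCS`.** For a globally minimal `W/ℚ` and a prime `p` with `RowC2 W p` (non-CM, `p > 3`,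
good ordinary, `E[p]` irreducible, (im)), `ord_{s=1} L(E,s) = 0`, `p ∤ ∏_ℓ c_ℓ`, `p ∤ #E(ℚ)_tors`,
the newform `f` of `W`, a Kolyvagin level `n` all of whose primes have cyclic `Ẽ(𝔽_ℓ)[p]`,
surjective discrete logarithms `ψ` and the certificate `kuriharaNumber f p n ψ ≠ 0`: `BSD(E,p)`
holds granted Kim's Thm. 1.8 (6) (`hKim`, fact B5), the period transfer at a good prime (`hϖ`),
modularity (`hmod`) and GZK (`hGZK`). Kim's hypotheses: `p ≥ 5` (`RowC2.five_le`), `ρ̄_{E,p}` onto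
(`surj_of_irr_of_bigIm`), good reduction (so the Manin hypothesis is vacuous, §1.3.5). Per pair;
NOT a class theorem; the consumer is `Typed.bsdp_of_kim_rankZero_of_kuriharaNumber_ne_zero`.
[cite: Kim2022StructureSelmer, Thm. 1.9 (6) (PDF p. 8), Cor. 1.6, §1.3.5]
[cite: GreenbergVatsal2000, §3, Remark 3.4] [cite: Miller2011LMS, Def. 1.1] -/
theorem RowC2.bsdp_rankZero_of_kim (hKim : Kim2022_rankZero_padicValRat_sha_of_kuriharaNumber_ne_zero)
    (hϖ : realPeriodRat_eq_unit_mul_plusPeriod) (hmod : hasEntireLFunction_rat)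
    (hGZK : rank_eq_analyticRank_of_analyticRank_le_one) (h : RowC2 W p) (hr0 : W.analyticRank = 0)
    (htam : ¬ p ∣ W.tamagawaProduct) (htors : ¬ p ∣ W.torsionOrder)
    {N : ℕ} [NeZero N] (f : CuspForm (Gamma0 N) 2) (hf : IsNewformOf W f)
    (n : ℕ) [NeZero n] (hn : Kato.IsKolyvaginProduct W p 1 n)
    (hcyc : ∀ (ℓ : ℕ) [Fact ℓ.Prime], ℓ ∣ n →
      Nat.card {P : ((WeierstrassCurve.integralModelInt W).map
          (Int.castRingHom (ZMod ℓ))).toAffine.Point // p • P = 0} ≤ p)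
    (ψ : (ℓ : ℕ) → (ZMod ℓ)ˣ →* Multiplicative (ZMod (p ^ 1)))
    (hψ : ∀ ℓ ∈ n.primeFactors, Function.Surjective (ψ ℓ))
    (hδ : kuriharaNumber f (p ^ 1) n ψ ≠ 0) : BSDp W p := by
  have h5 : 5 ≤ p := RowC2.five_le h
  obtain ⟨-, -, ⟨hgood, -⟩, hirr, him⟩ := h
  have hsurj : Surj W p := surj_of_irr_of_bigIm W p hirr him
  have hL : W.entireLFunction 1 ≠ 0 := (W.analyticRank_eq_zero_iff_holds (hmod W)).mp hr0
  exact Typed.bsdp_of_kim_rankZero_of_kuriharaNumber_ne_zero W p hKim hGZK h5 (Or.inl hgood) hsurj hL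
    htam htors f hf (hϖ W p h5 hgood hirr f hf) n hn hcyc ψ hψ hδ

/-- **Row C2, analytic rank one, ONE unit Kurihara number at a PRIME level and `ord_p #Ш_an = 0` ⇒
`BSD(E,p)` from Kim 2026 Thm. 1.8 (6) with Cor. 1.6 — no `hBCS`.** For `RowC2 W p`,
`ord_{s=1} L(E,s) = 1`, the lane's exact `#Ш_an = q` with `ord_p q = 0`, the newform `f`, a
Kolyvagin prime `ℓ` with cyclic `Ẽ(𝔽_ℓ)[p]`, a surjective discrete logarithm and
`kuriharaNumber f p ℓ ψ ≠ 0`: Kim's (6) gives `Ш(E/ℚ)[p^∞] = 0` (fact B6, `hKim`; "analytic rank one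
and semi-stable reduction at `p`" — good reduction is semi-stable), whence `BSD(E,p)` by
`Typed.bsdp_of_kim_rankOne_of_kuriharaNumber_ne_zero` (GZK `hGZK`; period transfer `hϖ`; modularity
`hmod` to read `r_an = 1` as `L(E,1) = 0`). Per pair; NOT a class theorem.
[cite: Kim2022StructureSelmer, Thm. 1.9 (6) (PDF p. 8), Cor. 1.6, §1.3.5]
[cite: GreenbergVatsal2000, §3, Remark 3.4] [cite: Miller2011LMS, Def. 1.1] -/
theorem RowC2.bsdp_rankOne_of_kim (hKim : Kim2022_rankOne_card_sha_eq_one_of_kuriharaNumber_ne_zero)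
    (hϖ : realPeriodRat_eq_unit_mul_plusPeriod) (hmod : hasEntireLFunction_rat)
    (hGZK : rank_eq_analyticRank_of_analyticRank_le_one) (h : RowC2 W p) (hr1 : W.analyticRank = 1)
    {q : ℚ} (hq : shaAn W = (q : ℂ)) (hv : padicValRat p q = 0)
    {N : ℕ} [NeZero N] (f : CuspForm (Gamma0 N) 2) (hf : IsNewformOf W f)
    (ℓ : ℕ) [Fact ℓ.Prime] (hℓ : Kato.IsKolyvaginPrime W p 1 ℓ)
    (hcyc : Nat.card {P : ((WeierstrassCurve.integralModelInt W).map
        (Int.castRingHom (ZMod ℓ))).toAffine.Point // p • P = 0} ≤ p)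
    (ψ : (ℓ' : ℕ) → (ZMod ℓ')ˣ →* Multiplicative (ZMod (p ^ 1)))
    (hψ : Function.Surjective (ψ ℓ)) (hδ : kuriharaNumber f (p ^ 1) ℓ ψ ≠ 0) : BSDp W p := by
  have h5 : 5 ≤ p := RowC2.five_le h
  obtain ⟨-, -, ⟨hgood, -⟩, hirr, him⟩ := h
  have hsurj : Surj W p := surj_of_irr_of_bigIm W p hirr him
  have hL : W.entireLFunction 1 = 0 := by
    by_contra hne
    have h0 := (W.analyticRank_eq_zero_iff_holds (hmod W)).mpr hne
    omega
  exact Typed.bsdp_of_kim_rankOne_of_kuriharaNumber_ne_zero W p hKim hGZK h5 (Or.inl hgood) hsurj hL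
    hr1 hq hv f hf (hϖ W p h5 hgood hirr f hf) ℓ hℓ hcyc ψ hψ hδ

/-- **Row C2, analytic rank zero, NON-ANOMALOUS `p` (`a_p ≢ 1 (mod p)`), ONE unit Kurihara number
⇒ `BSD(E,p)` from the PROOF-COVERED twin of Kim 2026 Thm. 1.8 (6)** (fact
`Kim2022_rankZero_padicValRat_sha_of_kuriharaNumber_ne_zero_of_localTorsionTrivial`, `hKim`; its
`(t0)` binder `#E(ℚ_p)[p] = 1` is discharged by good reduction and `¬ p ∣ a_p − 1`, tree theorem
`Kim2022_rankZero_padicValRat_sha_of_kuriharaNumber_ne_zero_of_nonAnomalous`). Same per-pair data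
and side conditions as `RowC2.bsdp_rankZero_of_kim`; the bookkeeping from Kim's
`ord_p(L(E,1)/Ω(W)) = ord_p #Ш(p)` to Miller's `BSD(E,p)` is the argument of
`Typed.bsdp_of_kim_rankZero_of_kuriharaNumber_ne_zero` verbatim (`bsdp_of_padicValRat_eq`). This is
the flag-free shape (ARM P reading `K26-(6)-shallow@t>0` does not apply at `t = 0`). Per pair.
[cite: Kim2022StructureSelmer, Thm. 1.9 (6) (PDF p. 8), Prop. 3.2 (PDF p. 15), Cor. 1.6, §1.3.5]
[cite: SilvermanAEC2009, VII.3 Prop. 3.1] [cite: GreenbergVatsal2000, §3, Remark 3.4]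
[cite: Miller2011LMS, Def. 1.1] -/
theorem RowC2.bsdp_rankZero_of_kim_nonAnomalous
    (hKim : Kim2022_rankZero_padicValRat_sha_of_kuriharaNumber_ne_zero_of_localTorsionTrivial)
    (hϖ : realPeriodRat_eq_unit_mul_plusPeriod) (hmod : hasEntireLFunction_rat)
    (hGZK : rank_eq_analyticRank_of_analyticRank_le_one) (h : RowC2 W p) (hr0 : W.analyticRank = 0)
    (hna : ¬ (p : ℤ) ∣ W.frobeniusTrace p - 1)
    (htam : ¬ p ∣ W.tamagawaProduct) (htors : ¬ p ∣ W.torsionOrder)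
    {N : ℕ} [NeZero N] (f : CuspForm (Gamma0 N) 2) (hf : IsNewformOf W f)
    (n : ℕ) [NeZero n] (hn : Kato.IsKolyvaginProduct W p 1 n)
    (hcyc : ∀ (ℓ : ℕ) [Fact ℓ.Prime], ℓ ∣ n →
      Nat.card {P : ((WeierstrassCurve.integralModelInt W).map
          (Int.castRingHom (ZMod ℓ))).toAffine.Point // p • P = 0} ≤ p)
    (ψ : (ℓ : ℕ) → (ZMod ℓ)ˣ →* Multiplicative (ZMod (p ^ 1)))
    (hψ : ∀ ℓ ∈ n.primeFactors, Function.Surjective (ψ ℓ))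
    (hδ : kuriharaNumber f (p ^ 1) n ψ ≠ 0) : BSDp W p := by
  have h5 : 5 ≤ p := RowC2.five_le h
  obtain ⟨-, -, ⟨hgood, -⟩, hirr, him⟩ := h
  have hsurj : Surj W p := surj_of_irr_of_bigIm W p hirr him
  have hL : W.entireLFunction 1 ≠ 0 := (W.analyticRank_eq_zero_iff_holds (hmod W)).mp hr0
  obtain ⟨hmw, hfin⟩ := hGZK W (by rw [hr0]; exact zero_le_one)
  have hmw0 : W.mordellWeilRank = 0 := by rw [hmw, hr0]
  obtain ⟨q, hq, hval⟩ := Kim2022_rankZero_padicValRat_sha_of_kuriharaNumber_ne_zero_of_nonAnomalous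
    hKim W p h5 hgood hna hsurj hL hfin f hf (hϖ W p h5 hgood hirr f hf) n hn hcyc ψ hψ hδ
  have hΩpos : 0 < W.realPeriodRat := by
    haveI : (W.baseChange ℝ).IsElliptic := by rw [baseChange]; infer_instance
    exact (W.baseChange ℝ).realPeriod_pos'
  have hΩ : (W.realPeriodRat : ℂ) ≠ 0 := by exact_mod_cast hΩpos.ne'
  rw [div_eq_iff hΩ] at hq
  have hq0 : q ≠ 0 := by
    rintro rfl
    apply hL
    rw [hq]; simp
  haveI : Finite W.sha := hfin
  have hsha : padicValNat p (Nat.card (AddCommGroup.primaryComponent W.sha p)) =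
      padicValNat p W.shaOrder := by
    unfold WeierstrassCurve.shaOrder
    exact padicValNat_card_addPrimaryComponent p
  have htam0 : padicValNat p W.tamagawaProduct = 0 := padicValNat.eq_zero_of_not_dvd htam
  have htors0 : padicValNat p W.torsionOrder = 0 := padicValNat.eq_zero_of_not_dvd htors
  refine bsdp_of_padicValRat_eq p hmw hfin q hq0 ?_ ?_
  · rw [WeierstrassCurve.leadingLCoeff, hr0, iteratedDeriv_zero, Nat.factorial_zero, Nat.cast_one,
      div_one, W.regulator_eq_one_of_rank_zero hmw0, mul_one, hq]
    push_cast; ring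
  · rw [hval, hsha, htam0, htors0]
    push_cast; ring

/-- **Row C2, analytic rank one, NON-ANOMALOUS `p`, ONE unit Kurihara number at a prime level and
`ord_p #Ш_an = 0` ⇒ `BSD(E,p)` from the PROOF-COVERED twin of Kim 2026 Thm. 1.8 (6)** (fact
`Kim2022_rankOne_card_sha_eq_one_of_kuriharaNumber_ne_zero_of_localTorsionTrivial`, `hKim`, read at a
good non-anomalous `p` by `Kim2022_rankOne_card_sha_eq_one_of_kuriharaNumber_ne_zero_of_nonAnomalous`):
`Ш(E/ℚ)[p^∞] = 0`, then `Typed.bsdp_of_shaAn_unit_of_noPTorsion`. Flag-free shape at `t = 0`. Per pair.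
[cite: Kim2022StructureSelmer, Thm. 1.9 (6) (PDF p. 8), Prop. 3.2 (PDF p. 15), Cor. 1.6, §1.3.5]
[cite: SilvermanAEC2009, VII.3 Prop. 3.1] [cite: GreenbergVatsal2000, §3, Remark 3.4]
[cite: Miller2011LMS, Def. 1.1] -/
theorem RowC2.bsdp_rankOne_of_kim_nonAnomalous
    (hKim : Kim2022_rankOne_card_sha_eq_one_of_kuriharaNumber_ne_zero_of_localTorsionTrivial)
    (hϖ : realPeriodRat_eq_unit_mul_plusPeriod) (hmod : hasEntireLFunction_rat)
    (hGZK : rank_eq_analyticRank_of_analyticRank_le_one) (h : RowC2 W p) (hr1 : W.analyticRank = 1)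
    (hna : ¬ (p : ℤ) ∣ W.frobeniusTrace p - 1)
    {q : ℚ} (hq : shaAn W = (q : ℂ)) (hv : padicValRat p q = 0)
    {N : ℕ} [NeZero N] (f : CuspForm (Gamma0 N) 2) (hf : IsNewformOf W f)
    (ℓ : ℕ) [Fact ℓ.Prime] (hℓ : Kato.IsKolyvaginPrime W p 1 ℓ)
    (hcyc : Nat.card {P : ((WeierstrassCurve.integralModelInt W).map
        (Int.castRingHom (ZMod ℓ))).toAffine.Point // p • P = 0} ≤ p)
    (ψ : (ℓ' : ℕ) → (ZMod ℓ')ˣ →* Multiplicative (ZMod (p ^ 1)))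
    (hψ : Function.Surjective (ψ ℓ)) (hδ : kuriharaNumber f (p ^ 1) ℓ ψ ≠ 0) : BSDp W p := by
  have h5 : 5 ≤ p := RowC2.five_le h
  obtain ⟨-, -, ⟨hgood, -⟩, hirr, him⟩ := h
  have hsurj : Surj W p := surj_of_irr_of_bigIm W p hirr him
  have hL : W.entireLFunction 1 = 0 := by
    by_contra hne
    have h0 := (W.analyticRank_eq_zero_iff_holds (hmod W)).mpr hne
    omega
  have hr : W.analyticRank ≤ 1 := by rw [hr1]
  obtain ⟨-, hfin⟩ := hGZK W hr
  have hcard := Kim2022_rankOne_card_sha_eq_one_of_kuriharaNumber_ne_zero_of_nonAnomalous hKim W p h5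
    hgood hna hsurj hL hr1 hfin f hf (hϖ W p h5 hgood hirr f hf) ℓ hℓ hcyc ψ hψ hδ
  exact Typed.bsdp_of_shaAn_unit_of_noPTorsion W p hGZK hr hq hv
    (Typed.noPTorsion_of_card_primaryComponent_eq_one W p hcard)

/-! ### The `(t0)` binder supplied per pair (anomalous primes): doors over the PROOF-COVERED twins
with `#E(ℚ_p)[p] = 1` as an explicit hypothesis — discharged per pair by the division-polynomial
certificate of `Literature/…/LocalTorsionDivisionPolynomialCertificateProofs.lean`
(`natCard_localPTorsion_eq_one_of_certificate_five`, a `decide` over `ℤ/p²`), or by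
`natCard_localPTorsion_eq_one_of_good_of_not_dvd_frobeniusTrace_sub_one` at a non-anomalous `p`
(then these doors specialise to the `_nonAnomalous` ones above). -/

/-- **Row C2, analytic rank zero, `#E(ℚ_p)[p] = 1` GIVEN, ONE unit Kurihara number ⇒ `BSD(E,p)`
from the PROOF-COVERED twin of Kim 2026 Thm. 1.8 (6)** (fact
`Kim2022_rankZero_padicValRat_sha_of_kuriharaNumber_ne_zero_of_localTorsionTrivial`, `hKim`, whose
`(t0)` binder is the hypothesis `ht0` — at an ANOMALOUS good `p` (`a_p ≡ 1 (mod p)`) it is decided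
per pair by a finite division-polynomial certificate (Kim Prop. 3.2; tree
`natCard_localPTorsion_eq_one_of_eval_preΨ'_ne_zero`), at a non-anomalous `p` by the point count).
Otherwise identical to `RowC2.bsdp_rankZero_of_kim_nonAnomalous` (same per-pair data, same
bookkeeping to Miller's `BSD(E,p)`). Flag-free shape (the twin is proof-covered at `t = 0`). Per pair.
[cite: Kim2022StructureSelmer, Thm. 1.9 (6) (PDF p. 8), Prop. 3.2 (PDF p. 15), Cor. 1.6, §1.3.5]
[cite: GreenbergVatsal2000, §3, Remark 3.4] [cite: Miller2011LMS, Def. 1.1] -/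
theorem RowC2.bsdp_rankZero_of_kim_of_localPTorsion
    (hKim : Kim2022_rankZero_padicValRat_sha_of_kuriharaNumber_ne_zero_of_localTorsionTrivial)
    (hϖ : realPeriodRat_eq_unit_mul_plusPeriod) (hmod : hasEntireLFunction_rat)
    (hGZK : rank_eq_analyticRank_of_analyticRank_le_one) (h : RowC2 W p) (hr0 : W.analyticRank = 0)
    (ht0 : Nat.card {Q : (W.baseChange ℚ_[p]).toAffine.Point // (p : ℕ) • Q = 0} = 1)
    (htam : ¬ p ∣ W.tamagawaProduct) (htors : ¬ p ∣ W.torsionOrder)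
    {N : ℕ} [NeZero N] (f : CuspForm (Gamma0 N) 2) (hf : IsNewformOf W f)
    (n : ℕ) [NeZero n] (hn : Kato.IsKolyvaginProduct W p 1 n)
    (hcyc : ∀ (ℓ : ℕ) [Fact ℓ.Prime], ℓ ∣ n →
      Nat.card {P : ((WeierstrassCurve.integralModelInt W).map
          (Int.castRingHom (ZMod ℓ))).toAffine.Point // p • P = 0} ≤ p)
    (ψ : (ℓ : ℕ) → (ZMod ℓ)ˣ →* Multiplicative (ZMod (p ^ 1)))
    (hψ : ∀ ℓ ∈ n.primeFactors, Function.Surjective (ψ ℓ))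
    (hδ : kuriharaNumber f (p ^ 1) n ψ ≠ 0) : BSDp W p := by
  have h5 : 5 ≤ p := RowC2.five_le h
  obtain ⟨-, -, ⟨hgood, -⟩, hirr, him⟩ := h
  have hsurj : Surj W p := surj_of_irr_of_bigIm W p hirr him
  have hL : W.entireLFunction 1 ≠ 0 := (W.analyticRank_eq_zero_iff_holds (hmod W)).mp hr0
  obtain ⟨hmw, hfin⟩ := hGZK W (by rw [hr0]; exact zero_le_one)
  have hmw0 : W.mordellWeilRank = 0 := by rw [hmw, hr0]
  obtain ⟨q, hq, hval⟩ := hKim W p h5 (Or.inl hgood) hsurj ht0 hL hfin f hf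
    (hϖ W p h5 hgood hirr f hf) n hn hcyc ψ hψ hδ
  have hΩpos : 0 < W.realPeriodRat := by
    haveI : (W.baseChange ℝ).IsElliptic := by rw [baseChange]; infer_instance
    exact (W.baseChange ℝ).realPeriod_pos'
  have hΩ : (W.realPeriodRat : ℂ) ≠ 0 := by exact_mod_cast hΩpos.ne'
  rw [div_eq_iff hΩ] at hq
  have hq0 : q ≠ 0 := by
    rintro rfl
    apply hL
    rw [hq]; simp
  haveI : Finite W.sha := hfin
  have hsha : padicValNat p (Nat.card (AddCommGroup.primaryComponent W.sha p)) =
      padicValNat p W.shaOrder := by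
    unfold WeierstrassCurve.shaOrder
    exact padicValNat_card_addPrimaryComponent p
  have htam0 : padicValNat p W.tamagawaProduct = 0 := padicValNat.eq_zero_of_not_dvd htam
  have htors0 : padicValNat p W.torsionOrder = 0 := padicValNat.eq_zero_of_not_dvd htors
  refine bsdp_of_padicValRat_eq p hmw hfin q hq0 ?_ ?_
  · rw [WeierstrassCurve.leadingLCoeff, hr0, iteratedDeriv_zero, Nat.factorial_zero, Nat.cast_one,
      div_one, W.regulator_eq_one_of_rank_zero hmw0, mul_one, hq]
    push_cast; ring
  · rw [hval, hsha, htam0, htors0]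
    push_cast; ring

/-- **Row C2, analytic rank one, `#E(ℚ_p)[p] = 1` GIVEN, ONE unit Kurihara number at a prime level
and `ord_p #Ш_an = 0` ⇒ `BSD(E,p)` from the PROOF-COVERED twin of Kim 2026 Thm. 1.8 (6)** (fact
`Kim2022_rankOne_card_sha_eq_one_of_kuriharaNumber_ne_zero_of_localTorsionTrivial`, `hKim`, `(t0)`
binder = hypothesis `ht0`, decided per pair as in `RowC2.bsdp_rankZero_of_kim_of_localPTorsion`):
`Ш(E/ℚ)[p^∞] = 0`, then `Typed.bsdp_of_shaAn_unit_of_noPTorsion`. Flag-free shape. Per pair.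
[cite: Kim2022StructureSelmer, Thm. 1.9 (6) (PDF p. 8), Prop. 3.2 (PDF p. 15), Cor. 1.6, §1.3.5]
[cite: GreenbergVatsal2000, §3, Remark 3.4] [cite: Miller2011LMS, Def. 1.1] -/
theorem RowC2.bsdp_rankOne_of_kim_of_localPTorsion
    (hKim : Kim2022_rankOne_card_sha_eq_one_of_kuriharaNumber_ne_zero_of_localTorsionTrivial)
    (hϖ : realPeriodRat_eq_unit_mul_plusPeriod) (hmod : hasEntireLFunction_rat)
    (hGZK : rank_eq_analyticRank_of_analyticRank_le_one) (h : RowC2 W p) (hr1 : W.analyticRank = 1)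
    (ht0 : Nat.card {Q : (W.baseChange ℚ_[p]).toAffine.Point // (p : ℕ) • Q = 0} = 1)
    {q : ℚ} (hq : shaAn W = (q : ℂ)) (hv : padicValRat p q = 0)
    {N : ℕ} [NeZero N] (f : CuspForm (Gamma0 N) 2) (hf : IsNewformOf W f)
    (ℓ : ℕ) [Fact ℓ.Prime] (hℓ : Kato.IsKolyvaginPrime W p 1 ℓ)
    (hcyc : Nat.card {P : ((WeierstrassCurve.integralModelInt W).map
        (Int.castRingHom (ZMod ℓ))).toAffine.Point // p • P = 0} ≤ p)
    (ψ : (ℓ' : ℕ) → (ZMod ℓ')ˣ →* Multiplicative (ZMod (p ^ 1)))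
    (hψ : Function.Surjective (ψ ℓ)) (hδ : kuriharaNumber f (p ^ 1) ℓ ψ ≠ 0) : BSDp W p := by
  have h5 : 5 ≤ p := RowC2.five_le h
  obtain ⟨-, -, ⟨hgood, -⟩, hirr, him⟩ := h
  have hsurj : Surj W p := surj_of_irr_of_bigIm W p hirr him
  have hL : W.entireLFunction 1 = 0 := by
    by_contra hne
    have h0 := (W.analyticRank_eq_zero_iff_holds (hmod W)).mpr hne
    omega
  have hr : W.analyticRank ≤ 1 := by rw [hr1]
  obtain ⟨-, hfin⟩ := hGZK W hr
  have hcard := hKim W p h5 (Or.inl hgood) hsurj ht0 hL hr1 hfin f hf (hϖ W p h5 hgood hirr f hf)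
    ℓ hℓ hcyc ψ hψ hδ
  exact Typed.bsdp_of_shaAn_unit_of_noPTorsion W p hGZK hr hq hv
    (Typed.noPTorsion_of_card_primaryComponent_eq_one W p hcard)

end Curve

end Summit.BirchSwinnertonDyer.Rank1Residual

end
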